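import Summits.BirchSwinnertonDyer.BirchSwinnertonDyer.Theorems.SignedLowerHalvesSprungLowerDivisibilityAtThreeCyclotomicCertOfLambda
import HarnessLib

/-!
# Crux `SprungLowerDivisibilityAtThree` (K1, item stmt-BirchSwinnertonDyer-19875), line `chromatic-common-zeros`: per-pair doors at
# analytic rank `≤ 1` WITHOUT the held input W-γ (`Kobayashi2013.cor13i_sharpFlat_minOrder_eq_one`) — the simple zero of one colour at
# `T = 0` as an exact per-pair DATUM (the `T`-coefficient of `L^•`)

Cell `bsd-ssimc` (host), width seat `cruxlead-stmt-BirchSwinnertonDyer-19875-w2` (g3) under the 19875 lead; `--supports` 19875 `--as helper`;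
theorems only; route-independent imports; closes NO item; registry unchanged (skeleton v8). K1, BSD and leaf X8 are NOT proved by anything
here; every per-pair hypothesis below is a displayed DATUM (census input) or a displayed named fact.

## Why

The per-pair doors of the line at `r_an ≤ 1` (R3 `…_of_noCommonZeroOffT_of_analyticRank_le_one`, p610611; R7 `…_of_sporadicCert_of_lamCert_…`,
p623422; w3's R5) carry FIVE named facts, of which one — W-γ `hKob : Kobayashi2013.cor13i_sharpFlat_minOrder_eq_one` (a COMPOSED, statement-only
citation: Kobayashi 2013 Cor. 1.3 (i) ∘ Sprung 2015 Cor. 5.4) — is used at exactly one place: in S4a (`stub_cyclotomicLowerAtT`, p608649) at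
`r_an = 1`, to supply «SOME colour has `ord_{T=0} L^• = 1`» (a simple zero, so that `ℓ_{(T)} Λ/(G^•) = 1 ≤ ℓ_{(T)} X^•` by control + GZK). S4a's
registered signature takes that input PER PAIR (`W.analyticRank = 1 → ∃ c₁, (chromaticL c₁ L♯ L♭).order = 1`). On the census it is an EXACT
datum: at `r = 1` both `L^•(0) = 0`, and `ord_T L^• = 1` iff the `T`-coefficient `c₁(L^•)` is non-zero — x8 R5 records `c₁(L♯) mod 3³`,
`c₁(L♭) mod 3²` (README §3.1, columns `c1_•_mod3^e`); a non-zero residue certifies the simple zero. THIS FILE re-threads R3 and R7 with that datum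
in place of `hKob` (§1 `…_of_noCommonZeroOffT_of_orderCert_…`, §2 `…_of_sporadicCert_of_lamCert_of_orderCert_…`), so a rank-one census cell
closes for K1 (both colours) modulo `h714`, `h3`, `hJ`, `hGZK` and four exact data {sporadic certificate, λ-bound, ζ_3-datum, `c₁ ≠ 0`} — no
W-γ. (At `r_an = 0` the doors R7⁰ / R0 need neither W-γ nor GZK already.)

References: [Sprung2012] Thm. 7.14 (p. 1504), Prop. 7.19 and Main Conj. 7.21 (p. 1505); [Sprung2024] §5.2 Lemma 5.6 (p. 41); [GrossZagier1986] Thm. (7.3);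
[Kolyvagin1990] Thm. A; [Kobayashi2013] Cor. 1.3 (i) (the fact REPLACED by a datum here); tree: `…CyclotomicLowerAtT` (p608649), `…ChromaticPerPairOffT`
(p610611), `…CyclotomicCertOfLambda` (p623422), `…SqueezeToCommonZeros` (p606891).
-/

set_option linter.dupNamespace false
set_option autoImplicit false

noncomputable section

open scoped Classical NumberField MatrixGroups ModularForm Polynomial

open NumberField IsDedekindDomain CongruenceSubgroup WeierstrassCurve Field Polynomial
  Literature.NumberTheory.EllipticCurves Literature.NumberTheory.EllipticCurves.ModularForms
  Literature.NumberTheory.EllipticCurves.ZpExtension Literature.NumberTheory.EllipticCurves.Sprung2017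
  Literature.NumberTheory.EllipticCurves.Sprung2012 Literature.NumberTheory.EllipticCurves.Rank1Residual
  Literature.NumberTheory.EllipticCurves.IwasawaAlgebra
  Summit.BirchSwinnertonDyer.BirchSwinnertonDyer.Theorems
  Summit.BirchSwinnertonDyer.Rank1Residual.Supersingular
  Summit.BirchSwinnertonDyer.Rank1Residual.X1.MuLambda

namespace Summit.BirchSwinnertonDyer.BirchSwinnertonDyer.Theorems.ChromaticCommonZeros

variable (W : WeierstrassCurve ℚ) [W.IsElliptic] [W.IsGloballyMinimal] (p : ℕ) [Fact p.Prime]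

/-! ### §1 R3 with the simple-zero datum in place of W-γ -/

/-- **(R3-ord) Analytic rank `≤ 1`, no common zero off `T`, and — when `r_an = 1` — a colour with a SIMPLE zero at `T = 0` (datum) ⟹ K1 for BOTH
colours.** Verbatim R3 (`sprungSharpFlatLowerDivisibility_of_noCommonZeroOffT_of_analyticRank_le_one`, p610611: S1 squeeze, S4a at `(T)`), with
S4a's per-pair simple-zero input fed by the displayed datum `hord` instead of the named fact `Kobayashi2013.cor13i_sharpFlat_minOrder_eq_one`.
CONDITIONAL on `h714`, `h3`, `hJ`, `hGZK` (displayed); PER PAIR; image-free; closes nothing.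
[cite: Sprung2012, Thm. 7.14 (3) (p. 1504), Prop. 7.19 (p. 1505)] [cite: Sprung2024, §5.2 Lemma 5.6 (p. 41)] [cite: GrossZagier1986, Thm. (7.3)] -/
theorem sprungSharpFlatLowerDivisibility_of_noCommonZeroOffT_of_orderCert_of_analyticRank_le_one
    (h714 : thm714_sharpFlatSelmerDual_finite_torsion) (h3 : realPeriodRat_eq_unit_mul_plusPeriod_three)
    (hJ : thm714seq_sharpFlatColemanKato_zetaJoint) (hGZK : rank_eq_analyticRank_of_analyticRank_le_one)
    (hX : ClassX8 W p) (hr : W.analyticRank ≤ 1)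
    (hord : ∀ {N : ℕ} [NeZero N] (f : CuspForm (Gamma0 N) 2) (Lsharp Lflat : IwasawaAlgebra p),
      IsNewformOf W f → IsSprungPair f p (W.frobeniusTrace p) Lsharp Lflat → W.analyticRank = 1 →
      ∃ c₁ : Chroma, PowerSeries.order (chromaticL c₁ Lsharp Lflat) = 1)
    (hnc : ∀ {N : ℕ} [NeZero N] (f : CuspForm (Gamma0 N) 2) (ϖ : ℚ) (Lsharp Lflat : IwasawaAlgebra p),
      IsNewformOf W f → (ϖ : ℝ) * W.realPeriodRat = plusPeriod f →
      IsSprungPair f p (W.frobeniusTrace p) Lsharp Lflat →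
      ∀ 𝔭 : PrimeSpectrum (IwasawaAlgebra p), 𝔭.asIdeal.height = 1 →
        (PowerSeries.X : IwasawaAlgebra p) ∉ 𝔭.asIdeal →
        ∃ (col' : Chroma) (G' : IwasawaAlgebra p),
          iwasawaToPowerSeries p G' =
            PowerSeries.C (ϖ : ℚ_[p]) * iwasawaToPowerSeries p (chromaticL col' Lsharp Lflat) ∧
          G' ∉ 𝔭.asIdeal)
    (col : Chroma) : SprungSharpFlatLowerDivisibility W p col := by
  intro κ γ hκ hγ hcv v hv g hg cneg c hH N hN f ϖ Lsharp Lflat hf hϖ hSP hcol D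
  haveI : NeZero N := hN
  obtain ⟨hp3, ⟨hgood, hap⟩, -⟩ := id hX
  subst hp3
  haveI : ContinuousSMul ℤ_[3] (W.tateModule 3) := TateModule.continuousSMul_padicInt
  haveI : Module.Free ℤ_[3] (W.tateModule 3) := W.module_free_tateModule_holds 3
  haveI : Module.Finite ℤ_[3] (W.tateModule 3) := W.module_finite_tateModule_holds 3
  have hp2 : (3 : ℕ) ≠ 2 := by decide
  obtain ⟨hfinD, htorD⟩ :=
    h714 W 3 hp2 hgood hap f hf κ γ hκ hγ hcv v hv g hg cneg c hH col Lsharp Lflat hSP hcol D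
  haveI := hfinD
  obtain ⟨I⟩ := Kato2004.nonempty_iwasawaH1Data_holds W 3 κ γ hκ hγ
  obtain ⟨Cs, Cf, hZ⟩ := hJ W 3 f ϖ κ γ hp2 hgood hap hf hϖ hκ hγ hcv v hv g hg cneg c hH I
  have hϖ1 : ‖(ϖ : ℚ_[3])‖ = 1 := X8_norm_periodRatio_eq_one h3 W 3 hX hf hϖ
  have hG := (span_C_units_mul_eq (PadicInt.mkUnits hϖ1) (chromaticL col Lsharp Lflat)).2
  rw [PadicInt.mkUnits_eq] at hG
  refine stub_squeezeToCommonZeros W 3 hX col κ γ hκ hγ hcv v hv g hg cneg c hH N hN f ϖ Lsharp Lflat hf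
    hϖ hSP hcol D htorD _ hG I Cs Cf hZ ?_
  intro 𝔭 h𝔭 hcommon
  by_cases hT : (PowerSeries.X : IwasawaAlgebra 3) ∈ 𝔭.asIdeal
  · -- `𝔭 = (T)`: S4a, the simple-zero input fed by the DATUM `hord`
    exact stub_cyclotomicLowerAtT h714 h3 hGZK W 3 hX col κ γ hκ hγ hcv v hv g hg cneg c hH N hN f ϖ Lsharp
      Lflat hf hϖ hSP hcol D htorD _ hG I Cs Cf hZ 𝔭 h𝔭 hT hr (fun h1 => hord f Lsharp Lflat hf hSP h1) hcommon
  · -- off `T` there is no common zero (the certificate)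
    obtain ⟨col', G', hG', hG'𝔭⟩ := hnc f ϖ Lsharp Lflat hf hϖ hSP 𝔭 h𝔭 hT
    exact absurd (hcommon col' G' hG') hG'𝔭

/-! ### §2 R7 with the simple-zero datum in place of W-γ -/

/-- **(R7-ord) K1 for BOTH colours at an X8 pair with `r_an ≤ 1` from four exact data and four named facts**: the SPORADIC certificate (R5 joint
verdict), the `λ`-certificate with its low-level `ζ_{3^j}` data (p623422), and — when `r_an = 1` — a colour with `ord_{T=0} L^• = 1` (the
`T`-coefficient datum), modulo `h714`, `h3`, `hJ`, `hGZK`; NO W-γ. (§1 ∘ `noCommonZeroOffT_of_sporadicCert_of_lamCert`.) PER PAIR; closes nothing.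
[cite: Sprung2012, Thm. 7.14 (p. 1504), Prop. 7.19 and Main Conj. 7.21 (p. 1505)] [cite: Washington1997, §7.1] [cite: GrossZagier1986, Thm. (7.3)] -/
theorem sprungSharpFlatLowerDivisibility_of_sporadicCert_of_lamCert_of_orderCert_of_analyticRank_le_one
    (h714 : thm714_sharpFlatSelmerDual_finite_torsion) (h3 : realPeriodRat_eq_unit_mul_plusPeriod_three)
    (hJ : thm714seq_sharpFlatColemanKato_zetaJoint) (hGZK : rank_eq_analyticRank_of_analyticRank_le_one)
    (hX : ClassX8 W p) (hr : W.analyticRank ≤ 1) {j₀ : ℕ}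
    (hord : ∀ {N : ℕ} [NeZero N] (f : CuspForm (Gamma0 N) 2) (Lsharp Lflat : IwasawaAlgebra p),
      IsNewformOf W f → IsSprungPair f p (W.frobeniusTrace p) Lsharp Lflat → W.analyticRank = 1 →
      ∃ c₁ : Chroma, PowerSeries.order (chromaticL c₁ Lsharp Lflat) = 1)
    (hS : ∀ {N : ℕ} [NeZero N] (f : CuspForm (Gamma0 N) 2) (ϖ : ℚ) (Lsharp Lflat : IwasawaAlgebra p),
      IsNewformOf W f → (ϖ : ℝ) * W.realPeriodRat = plusPeriod f →
      IsSprungPair f p (W.frobeniusTrace p) Lsharp Lflat →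
      ∀ 𝔭 : PrimeSpectrum (IwasawaAlgebra p), 𝔭.asIdeal.height = 1 →
        (p : IwasawaAlgebra p) ∉ 𝔭.asIdeal →
        (¬ ∃ n : ℕ, ((cyclotomicOmega p n).map (Int.castRingHom ℤ_[p]) : PowerSeries ℤ_[p]) ∈ 𝔭.asIdeal) →
        ∃ (col' : Chroma) (G' : IwasawaAlgebra p),
          iwasawaToPowerSeries p G' =
            PowerSeries.C (ϖ : ℚ_[p]) * iwasawaToPowerSeries p (chromaticL col' Lsharp Lflat) ∧
          G' ∉ 𝔭.asIdeal)
    (hΛ : ∀ {N : ℕ} [NeZero N] (f : CuspForm (Gamma0 N) 2) (Lsharp Lflat : IwasawaAlgebra p),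
      IsNewformOf W f → IsSprungPair f p (W.frobeniusTrace p) Lsharp Lflat →
      (∃ c₀ : Chroma, chromaticL c₀ Lsharp Lflat ≠ 0 ∧ lam (chromaticL c₀ Lsharp Lflat) < (p ^ j₀).totient) ∧
      ∀ j : ℕ, 1 ≤ j → j < j₀ → ∃ c : Chroma,
        ¬ ((((cyclotomic (p ^ j) ℤ).comp (X + 1)).map (Int.castRingHom ℤ_[p]) : ℤ_[p][X]) : IwasawaAlgebra p) ∣
            chromaticL c Lsharp Lflat)
    (col : Chroma) : SprungSharpFlatLowerDivisibility W p col :=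
  sprungSharpFlatLowerDivisibility_of_noCommonZeroOffT_of_orderCert_of_analyticRank_le_one W p h714 h3 hJ hGZK hX hr hord
    (noCommonZeroOffT_of_sporadicCert_of_lamCert W p h3 hX hS hΛ) col

/-- **Book-keeping: the datum `ord_{T=0} L^• = 1` from the `T`-coefficient.** For `L ∈ Λ` with `L(0) = 0` and `coeff_1 L ≠ 0`, `ord_T L = 1` —
the census form of `hord` (x8 R5 columns `c1_•_mod3^e`: a non-zero residue certifies `coeff_1 L^• ≠ 0`; `L^•(0) = 0` at `r = 1`). [folklore] -/
theorem order_eq_one_of_constantCoeff_eq_zero_of_coeff_one_ne_zero {L : IwasawaAlgebra p}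
    (h0 : PowerSeries.constantCoeff L = 0) (h1 : PowerSeries.coeff 1 L ≠ 0) : PowerSeries.order L = 1 := by
  refine PowerSeries.order_eq_nat.mpr ⟨by simpa using h1, fun i hi ↦ ?_⟩
  interval_cases i
  simpa using h0

end Summit.BirchSwinnertonDyer.BirchSwinnertonDyer.Theorems.ChromaticCommonZeros

end
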